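import Mathlib

/-!
# Gerstenhaber's theorem (inequality): a linear space of nilpotent `n × n` matrices has dimension `≤ n(n−1)/2`

Source (held, read at the page): [dSP13] = C. de Seguins Pazzis, *On Gerstenhaber's theorem for spaces
of nilpotent matrices over a skew field*, Linear Algebra Appl. 438 (2013) 4426–4438, arXiv:1210.4951
[deSeguinsPazzis2013Gerstenhaber], §2 (Lemma 5, the "adapted vector" lemma) and §3 (proof of the
inequality statement, Theorem 2 (a)); the theorem is M. Gerstenhaber, *On nilalgebras and linear
varieties of nilpotent matrices I*, Amer. J. Math. 80 (1958) 614–622, Thm. 1 [Gerstenhaber1958]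
(for fields with `≥ n` elements; all fields: Mathes–Omladič–Radjavi 1991, MacDonald et al.).

* "Theorem 1 (Gerstenhaber, Serezhkin). Assume that `𝕂` is commutative, and let `𝒱` be a nilpotent
  linear subspace of the `𝕂`-vector space `Mat_n(𝕂)`. Then `dim_𝕂 𝒱 ≤ binom(n,2)`, and equality occurs
  if and only if `𝒱` is similar to `NT_n(𝕂)`."
* "Lemma 5. Let `𝒱` be a subset of `Mat_n(𝕂)` which is closed under addition and contains only
  nilpotent matrices, and denote by `(e_1,…,e_n)` the canonical basis of the `𝕂`-vector space `𝕂^n`.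
  Then one of the vectors `e_1,…,e_n` is `𝒱`-adapted." (`X` is `𝒱`-adapted if it is non-zero and no
  matrix of `𝒱` has `X𝕂` as its column space; for `X = e_i`: no non-zero matrix of `𝒱` has all its
  rows other than the `i`-th equal to zero.)

What is here (commutative field `K = 𝕂 = 𝕂₀`, `q = 1`): `exists_adapted` (Lemma 5) and
`finrank_le_choose_two` (Theorem 1, inequality, for `Fin n`), `finrank_le_card_choose_two` (any
finite index type).  Proof of Lemma 5 as in [dSP13] by induction on `n` (pass to the matrices of `𝒱`
with zero `k`-th row, compressed to the indices `≠ k`), except that the final "cycle of `f`" step is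
replaced by the remark that `k ↦ f(k)` is injective, hence a fixed-point-free permutation, so that
the sum `Σ_k a_k E_{f(k),k} ∈ 𝒱` is an invertible monomial matrix — not nilpotent.  Proof of the
inequality verbatim from §3: with `e_n` adapted, `dim 𝒱 = dim K(𝒲₁) + dim C(𝒱) ≤ binom(n−1,2) + (n−1)`.

NOT here: the case of equality (Theorem 1, second half; [dSP13] §4), the skew-field version
(Theorem 2 with the factor `q`), Corollary 3 (additive subgroups over finite fields).
THEOREMS ONLY (no new definitions, no named facts).
-/

open Matrix

namespace Literature.LinearAlgebra.Matrix.GerstenhaberNilpotentSubspace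

variable {K : Type*} [Field K]

/-! ## Compression to the indices `≠ k` -/

/-- Compressing along `Fin.succAbove k` preserves the identity matrix. [folklore] -/
private theorem submatrix_one_succAbove {n : ℕ} (k : Fin (n + 1)) :
    (1 : Matrix (Fin (n + 1)) (Fin (n + 1)) K).submatrix k.succAbove k.succAbove = 1 := by
  ext a b
  simp only [submatrix_apply, one_apply, (Fin.succAbove_right_injective (p := k)).eq_iff]

/-- If the `k`-th ROW of `A` vanishes, compression to the indices `≠ k` commutes with powers
(`A` is block upper-triangular for the decomposition `𝕂^n = ⟨e_j : j ≠ k⟩ ⊕ ⟨e_k⟩`). [folklore] -/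
private theorem submatrix_pow_of_row_eq_zero {n : ℕ} (k : Fin (n + 1))
    (A : Matrix (Fin (n + 1)) (Fin (n + 1)) K) (hrow : ∀ l, A k l = 0) (p : ℕ) :
    (A ^ p).submatrix k.succAbove k.succAbove = (A.submatrix k.succAbove k.succAbove) ^ p := by
  induction p with
  | zero => rw [pow_zero, pow_zero, submatrix_one_succAbove]
  | succ p ih =>
    rw [pow_succ, pow_succ, ← ih]
    ext a b
    rw [submatrix_apply, mul_apply, mul_apply, Fin.sum_univ_succAbove _ k, hrow, mul_zero, zero_add]
    rfl

/-- If the `k`-th COLUMN of `A` vanishes off the diagonal, compression to the indices `≠ k`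
commutes with powers (`A` is block lower-triangular). [folklore] -/
private theorem submatrix_pow_of_col_eq_zero {n : ℕ} (k : Fin (n + 1))
    (A : Matrix (Fin (n + 1)) (Fin (n + 1)) K) (hcol : ∀ a, A (k.succAbove a) k = 0) (p : ℕ) :
    (A ^ p).submatrix k.succAbove k.succAbove = (A.submatrix k.succAbove k.succAbove) ^ p := by
  induction p with
  | zero => rw [pow_zero, pow_zero, submatrix_one_succAbove]
  | succ p ih =>
    rw [pow_succ', pow_succ', ← ih]
    ext a b
    rw [submatrix_apply, mul_apply, mul_apply, Fin.sum_univ_succAbove _ k, hcol, zero_mul, zero_add]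
    rfl

/-- If the `k`-th column of a nilpotent `A` vanishes off the diagonal, its diagonal entry vanishes
too (`(A^p)_{kk} = (A_{kk})^p`). [folklore] -/
private theorem apply_eq_zero_of_col_eq_zero_of_isNilpotent {n : ℕ} (k : Fin (n + 1))
    (A : Matrix (Fin (n + 1)) (Fin (n + 1)) K) (hcol : ∀ a, A (k.succAbove a) k = 0)
    (hA : IsNilpotent A) : A k k = 0 := by
  have hdiag : ∀ p : ℕ, (A ^ p) k k = (A k k) ^ p := by
    intro p
    induction p with
    | zero => simp
    | succ p ih =>
      rw [pow_succ, mul_apply, Fin.sum_univ_succAbove _ k, ih, pow_succ]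
      simp [hcol]
  obtain ⟨p, hp⟩ := hA
  have h := hdiag p
  rw [hp, Matrix.zero_apply] at h
  exact IsNilpotent.eq_zero ⟨p, h.symm⟩

/-- Compression to the indices `≠ k`, as a linear map. [folklore] -/
private theorem submatrix_succAbove_linear {n : ℕ} (k : Fin (n + 1)) :
    ∃ L : Matrix (Fin (n + 1)) (Fin (n + 1)) K →ₗ[K] Matrix (Fin n) (Fin n) K,
      ∀ A, L A = A.submatrix k.succAbove k.succAbove :=
  ⟨{ toFun := fun A => A.submatrix k.succAbove k.succAbove
     map_add' := fun _ _ => rfl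
     map_smul' := fun _ _ => rfl }, fun _ => rfl⟩

/-! ## Lemma 5: an adapted basis vector -/

/-- **[dSP13] Lemma 5 (adapted basis vector), commutative case.** If `𝒱` is a linear subspace of
nilpotent `(n+1) × (n+1)` matrices, then for some index `i` no non-zero matrix of `𝒱` has all its
rows other than the `i`-th equal to zero ("`e_i` is `𝒱`-adapted"). [cite: deSeguinsPazzis2013Gerstenhaber, Lemma 5] -/
theorem exists_adapted : ∀ (n : ℕ) (V : Submodule K (Matrix (Fin (n + 1)) (Fin (n + 1)) K)),
    (∀ A ∈ V, IsNilpotent A) →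
      ∃ i : Fin (n + 1), ∀ A ∈ V, (∀ j, j ≠ i → ∀ l, A j l = 0) → A = 0 := by
  intro n
  induction n with
  | zero =>
    intro V hV
    refine ⟨0, fun A hA _ => ?_⟩
    -- a nilpotent `1 × 1` matrix vanishes
    have h00 : A 0 0 = 0 := by
      obtain ⟨p, hp⟩ := hV A hA
      have hdiag : ∀ q : ℕ, (A ^ q) 0 0 = (A 0 0) ^ q := by
        intro q
        induction q with
        | zero => simp
        | succ q ih => rw [pow_succ, mul_apply, Fin.sum_univ_one, ih, pow_succ]
      have h := hdiag p
      rw [hp, Matrix.zero_apply] at h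
      exact IsNilpotent.eq_zero ⟨p, h.symm⟩
    ext a b
    rw [Fin.fin_one_eq_zero a, Fin.fin_one_eq_zero b, h00, Matrix.zero_apply]
  | succ n ih =>
    intro V hV
    by_contra hne
    push Not at hne
    -- for every `i`, a non-zero matrix of `V` supported on row `i`
    choose A hAV hArow hAne using hne
    -- compress along each index `k`
    have key : ∀ k : Fin (n + 2), ∃ i : Fin (n + 2), i ≠ k ∧
        ∀ j l, ¬ (j = i ∧ l = k) → A i j l = 0 := by
      intro k
      obtain ⟨L, hL⟩ := submatrix_succAbove_linear (K := K) k
      -- `𝒲 = {M ∈ V : row k of M = 0}`, compressed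
      let W : Submodule K (Matrix (Fin (n + 2)) (Fin (n + 2)) K) :=
        { carrier := {M | M ∈ V ∧ ∀ l, M k l = 0}
          add_mem' := fun {a b} ha hb => ⟨V.add_mem ha.1 hb.1, fun l => by
            rw [Matrix.add_apply, ha.2 l, hb.2 l, add_zero]⟩
          zero_mem' := ⟨V.zero_mem, fun _ => rfl⟩
          smul_mem' := fun c {a} ha => ⟨V.smul_mem c ha.1, fun l => by
            rw [Matrix.smul_apply, ha.2 l, smul_zero]⟩ }
      have hWmem : ∀ M, M ∈ W ↔ M ∈ V ∧ ∀ l, M k l = 0 := fun M => Iff.rfl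
      have hWnil : ∀ B ∈ W.map L, IsNilpotent B := by
        rintro B ⟨M, hM, rfl⟩
        have hM' : M ∈ V ∧ ∀ l, M k l = 0 := hM
        obtain ⟨p, hp⟩ := hV M hM'.1
        refine ⟨p, ?_⟩
        rw [hL, ← submatrix_pow_of_row_eq_zero k M hM'.2 p, hp]
        rfl
      obtain ⟨i', hi'⟩ := ih (W.map L) hWnil
      refine ⟨k.succAbove i', Fin.succAbove_ne k i', fun j l hjl => ?_⟩
      set i := k.succAbove i' with hi
      -- `A i ∈ 𝒲` and its compression is supported on row `i'`, hence vanishes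
      have hAW : A i ∈ W := (hWmem _).2 ⟨hAV i, fun l => hArow i k (Fin.succAbove_ne k i').symm l⟩
      have hcomp : L (A i) = 0 := by
        refine hi' _ ⟨A i, hAW, rfl⟩ fun a ha b => ?_
        rw [hL, submatrix_apply]
        exact hArow i _ (fun h => ha (Fin.succAbove_right_injective (h.trans hi))) _
      by_cases hj : j = i
      · subst hj
        have hl : l ≠ k := fun h => hjl ⟨rfl, h⟩
        obtain ⟨b, rfl⟩ := Fin.exists_succAbove_eq hl
        have h := congrFun (congrFun hcomp i') b
        rwa [hL, submatrix_apply, Matrix.zero_apply] at h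
      · exact hArow i j hj l
    choose f hfk hf using key
    -- the chosen matrices are `a_k • E_{f k, k}` with `a_k ≠ 0`
    have hentry : ∀ k, A (f k) (f k) k ≠ 0 := by
      intro k h0
      apply hAne (f k)
      ext j l
      rw [Matrix.zero_apply]
      by_cases hjl : j = f k ∧ l = k
      · rw [hjl.1, hjl.2, h0]
      · exact hf k j l hjl
    -- `f` is injective, hence a (fixed-point-free) permutation
    have hfinj : Function.Injective f := by
      intro k k' hkk'
      by_contra hne'
      have h := hf k' (f k) k (fun h => hne' h.2)
      rw [← hkk'] at h
      exact hentry k h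
    have hfbij : Function.Bijective f := Finite.injective_iff_bijective.1 hfinj
    -- the monomial matrix `S = Σ_k A (f k)` lies in `V` and is invertible
    set S : Matrix (Fin (n + 2)) (Fin (n + 2)) K := ∑ k, A (f k) with hS
    have hSV : S ∈ V := V.sum_mem fun k _ => hAV (f k)
    have hSapply : ∀ j l, S j l = if j = f l then A (f l) (f l) l else 0 := by
      intro j l
      rw [hS, Matrix.sum_apply, Finset.sum_eq_single l]
      · by_cases hj : j = f l
        · rw [if_pos hj, hj]
        · rw [if_neg hj]
          exact hf l j l fun h => hj h.1
      · intro k _ hkl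
        exact hf k j l fun h => hkl h.2.symm
      · intro h; exact absurd (Finset.mem_univ l) h
    set T : Matrix (Fin (n + 2)) (Fin (n + 2)) K :=
      Matrix.of fun l j => if j = f l then (A (f l) (f l) l)⁻¹ else 0 with hT
    have hST : S * T = 1 := by
      ext j j'
      rw [mul_apply, one_apply]
      by_cases hjj : j = j'
      · subst hjj
        obtain ⟨l₀, hl₀⟩ := hfbij.2 j
        rw [Finset.sum_eq_single l₀]
        · rw [hSapply, hT, of_apply, if_pos hl₀.symm, if_pos hl₀.symm, if_pos rfl,
            mul_inv_cancel₀ (hentry l₀)]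
        · intro l _ hl
          rw [hT, of_apply, if_neg, mul_zero]
          intro h
          exact hl (hfinj (h.symm.trans hl₀.symm) )
        · intro h; exact absurd (Finset.mem_univ l₀) h
      · rw [if_neg hjj]
        refine Finset.sum_eq_zero fun l _ => ?_
        rw [hSapply, hT, of_apply]
        by_cases h1 : j = f l
        · rw [if_pos h1, if_neg, mul_zero]
          intro h2
          exact hjj (h1.trans h2.symm)
        · rw [if_neg h1, zero_mul]
    have hSunit : IsUnit S := ⟨⟨S, T, hST, mul_eq_one_comm.1 hST⟩, rfl⟩
    -- but `S` is nilpotent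
    obtain ⟨p, hp⟩ := hV S hSV
    have h1 : IsUnit (S ^ p) := hSunit.pow p
    rw [hp, isUnit_zero_iff] at h1
    exact zero_ne_one h1

/-! ## Theorem 1 (inequality) -/

/-- **Gerstenhaber's theorem, inequality statement** ([dSP13] Theorem 1 / Theorem 2 (a) with `q = 1`;
Gerstenhaber 1958): a linear subspace of `Mat_n(K)` consisting of nilpotent matrices has dimension
`≤ binom(n, 2) = n(n−1)/2`. [cite: deSeguinsPazzis2013Gerstenhaber, Theorem 1] -/
theorem finrank_le_choose_two : ∀ (n : ℕ) (V : Submodule K (Matrix (Fin n) (Fin n) K)),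
    (∀ A ∈ V, IsNilpotent A) → Module.finrank K V ≤ n.choose 2 := by
  intro n
  induction n with
  | zero =>
    intro V _
    have : V = ⊥ := Subsingleton.elim _ _
    rw [this, finrank_bot]
    exact Nat.zero_le _
  | succ n ih =>
    intro V hV
    obtain ⟨i, hi⟩ := exists_adapted n V hV
    obtain ⟨L, hL⟩ := submatrix_succAbove_linear (K := K) i
    -- `C(M)` = the `i`-th column off the diagonal
    let C : Matrix (Fin (n + 1)) (Fin (n + 1)) K →ₗ[K] (Fin n → K) :=
      { toFun := fun M a => M (i.succAbove a) i
        map_add' := fun _ _ => rfl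
        map_smul' := fun _ _ => rfl }
    have hC : ∀ M a, C M a = M (i.succAbove a) i := fun M a => rfl
    obtain ⟨CV, hCV⟩ : ∃ CV : V →ₗ[K] (Fin n → K), ∀ v, CV v = C v :=
      ⟨C ∘ₗ V.subtype, fun _ => rfl⟩
    -- `dim V = dim range C + dim 𝒲₁`
    have hsum := LinearMap.finrank_range_add_finrank_ker CV
    have hrange : Module.finrank K (LinearMap.range CV) ≤ n := by
      calc Module.finrank K (LinearMap.range CV) ≤ Module.finrank K (Fin n → K) :=
            Submodule.finrank_le _
        _ = n := by rw [Module.finrank_fintype_fun_eq_card, Fintype.card_fin]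
    -- `𝒲₁ = ker C` compresses injectively onto a nilpotent subspace of `Mat_{n}(K)`
    obtain ⟨KW, hKWapply⟩ : ∃ KW : LinearMap.ker CV →ₗ[K] Matrix (Fin n) (Fin n) K,
        ∀ M : LinearMap.ker CV, KW M = (M : Matrix (Fin (n + 1)) (Fin (n + 1)) K).submatrix
          i.succAbove i.succAbove :=
      ⟨L ∘ₗ V.subtype ∘ₗ (LinearMap.ker CV).subtype, fun M => hL _⟩
    have hcol : ∀ M : LinearMap.ker CV, ∀ a, (M : Matrix (Fin (n + 1)) (Fin (n + 1)) K)
        (i.succAbove a) i = 0 := by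
      intro M a
      have h := LinearMap.mem_ker.1 M.2
      rw [hCV] at h
      exact congrFun h a
    have hzero : ∀ A ∈ V, (∀ a, A (i.succAbove a) i = 0) →
        A.submatrix i.succAbove i.succAbove = 0 → A = 0 := by
      intro A hA hcolA hsub
      refine hi _ hA fun j hj l => ?_
      obtain ⟨a, rfl⟩ := Fin.exists_succAbove_eq hj
      by_cases hl : l = i
      · rw [hl]; exact hcolA a
      · obtain ⟨b, rfl⟩ := Fin.exists_succAbove_eq hl
        have h := congrFun (congrFun hsub a) b
        rwa [submatrix_apply, Matrix.zero_apply] at h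
    have hinj : Function.Injective KW := by
      intro M M' h
      rw [hKWapply, hKWapply] at h
      have hdiff : ((M : V) : Matrix (Fin (n + 1)) (Fin (n + 1)) K) - ((M' : V) : Matrix _ _ K) = 0 := by
        refine hzero _ (V.sub_mem M.1.2 M'.1.2) (fun a => ?_) ?_
        · rw [Matrix.sub_apply, hcol M a, hcol M' a, sub_zero]
        · ext a b
          rw [submatrix_apply, Matrix.sub_apply, Matrix.zero_apply]
          have hab := congrFun (congrFun h a) b
          rw [submatrix_apply, submatrix_apply] at hab
          rw [hab, sub_self]
      exact Subtype.ext (Subtype.ext (sub_eq_zero.1 hdiff))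
    have hnil : ∀ B ∈ LinearMap.range KW, IsNilpotent B := by
      rintro B ⟨M, rfl⟩
      obtain ⟨p, hp⟩ := hV _ M.1.2
      refine ⟨p, ?_⟩
      rw [hKWapply, ← submatrix_pow_of_col_eq_zero i _ (hcol M) p, hp]
      rfl
    have hker : Module.finrank K (LinearMap.ker CV) ≤ n.choose 2 := by
      rw [← LinearMap.finrank_range_of_inj hinj]
      exact ih _ hnil
    have h2 : (n + 1).choose 2 = n + n.choose 2 := by
      rw [show 2 = 1 + 1 from rfl, Nat.choose_succ_succ', Nat.choose_one_right]
    rw [h2]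
    omega

/-- **Gerstenhaber's theorem, inequality statement, any finite index type**: a linear subspace of
nilpotent `ι × ι` matrices over a field has dimension `≤ binom(|ι|, 2)`. [cite: deSeguinsPazzis2013Gerstenhaber, Theorem 1] -/
theorem finrank_le_card_choose_two {ι : Type*} [Fintype ι] [DecidableEq ι]
    (V : Submodule K (Matrix ι ι K)) (hV : ∀ A ∈ V, IsNilpotent A) :
    Module.finrank K V ≤ (Fintype.card ι).choose 2 := by
  set e := Fintype.equivFin ι with he
  set R := Matrix.reindexAlgEquiv K K e with hR
  have hmap : ∀ A ∈ V.map R.toLinearEquiv.toLinearMap, IsNilpotent A := by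
    rintro A ⟨B, hB, rfl⟩
    exact (hV B hB).map R
  have h := finrank_le_choose_two (Fintype.card ι) (V.map R.toLinearEquiv.toLinearMap) hmap
  rwa [LinearEquiv.finrank_map_eq] at h

end Literature.LinearAlgebra.Matrix.GerstenhaberNilpotentSubspace
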